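import Summits.ValiantsHypothesis.ValiantsHypothesis.Theorems.KPlusLogSqLawValuativeDoorRoofExcess

/-!
# LINE `valuative_door` (crux `WeakLifting`, stmt-ValiantsHypothesis-19561) — THE AP-FREE LAW (all `K`, ALL symmetric letters):
# on a support without three-term progressions `npEdges ≤ 3K − 4`, the Sidon value — singular letters and four-letter coincidences included

HONEST FRAMING.  Helper (cell `pub-symmetroid`, seat val-sym-lift-p1 g25, 2026-08-29; `--supports 19561 --as helper`).  Width two, ALL
`K`, every field, every residue characteristic, raw `domCount` predicate.  `valAPFree_unfolded`: a symmetric `2 × 2` lacunary pencil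
`Σ_l X^{d_l} S_l` whose support has no three-term progression has at most `(2K − 3) + K` dominant exponents, i.e. `npEdges ≤ 3K − 4` —
the binders of ✓ `valAPFreeSupport_unfolded` (g24) WITHOUT its letter hypothesis, and of ✓ `valSidonTwo_unfolded` (g23) with Sidon
weakened to «no 3-AP».  SHARP (✓ `valSidonTwo_sharp_unfolded`: Sidon supports reach `3K − 3` dominant exponents) and the hypothesis is
NECESSARY (✓ `valNonSidonFive_unfolded`: the support `(0,3,4,8,14)` with the progression `0 + 8 = 4 + 4` has `14 > 12`).  READING, with
the two predecessors: **the width-two symmetric valuative row exceeds the Sidon value `3K − 4` if and only if the support carries a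
three-term progression with a leading cancellation** — four-letter coincidences `d_x + d_w = d_y + d_z`, cancelling or not, and
valuatively singular letters never add a Newton edge.  PROOF: every dominant class is TAME (its entries are `v`-bounded by its
coefficient: roof-excess lemma ✓ `log_polar_le_roof` with the roof of two dominance lines), hence has a LEADING pair
(`v(G_{ij}) = v(f_E)`); two leading pairs are never NESTED (`not_nested_leading_of_apfree`: g23's roof argument on the Gram minor of the
four letters, where a tying non-reversal Leibniz term would need a roof-touching off-diagonal cell of the quadruple with exponent outside
`[min(B,C), max(B,C)]`, excluded by ✓ `touching_polar_between`, or a touching diagonal cell, excluded since `2 d_b, 2 d_c ∉ {B, C}` on an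
AP-free support); so leading pairs form a chain of at most `2K − 3` (✓ `card_le_of_pairChain`) and the diagonal adds at most `K`
(`domCount_le_of_apfree_sorted`; letters sorted by `Tuple.sort`).  A linear law for the UNRESTRICTED row is not claimed
(✓ `…FGPlusOne`: open-problem-hard).  Nothing here is a stub of the line or closes anything; no bearing on vW / vB, `TropicalB`,
`MatrixDescartes` (18050) or VP ≠ VNP.  [roof + Gram rank 3 + max-excess propagation]
-/

set_option linter.dupNamespace false
set_option autoImplicit false

namespace Summit.ValiantsHypothesis.ValiantsHypothesis.Theorems.KPlusLogSqLaw.ValDoor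

open Polynomial Finset Matrix
open scoped BigOperators Classical

variable {F : Type*} [Field F]

/-! ## §1 Leading pairs are never nested -/

/-- **NESTED LEADING PAIRS ARE NEVER BOTH DOMINANT (no three-term progressions, ALL letters).**  For four letters `a < b < c < e`
(strictly increasing exponents, support without 3-APs) whose pair classes `B = d_a + d_e ≠ C = d_b + d_c` are both dominant and which
LEAD their classes (`v(G_{ae}) = v(f_B)`, `v(G_{bc}) = v(f_C)`): contradiction.  g23's roof argument (✓ `not_nested_dominant_of_sidon`)
with the Sidon bookkeeping replaced by the roof-excess lemma (every entry under the roof) and `touching_polar_between` (a tying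
non-reversal Leibniz term of the `{a,b,c,e}` Gram minor would need a touching off-diagonal cell with exponent outside
`[min(B,C), max(B,C)]` or a touching diagonal cell — neither exists; AP-free: `2 d_b, 2 d_c ≠ B`). [roof + propagation] -/
theorem not_nested_leading_of_apfree (v : AbsoluteValue F ℝ) (hv : IsNonarchimedean v) {K : ℕ} (d : Fin K → ℕ)
    (hd : StrictMono d) (S : Fin K → Matrix (Fin 2) (Fin 2) F) (hS : ∀ l, (S l).IsSymm)
    (hap : ∀ l₁ l₂ l₃ : Fin K, d l₁ + d l₂ = d l₃ + d l₃ → l₁ = l₃ ∧ l₂ = l₃)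
    {a b c e : Fin K} (hab : a < b) (hbc : b < c) (hce : c < e)
    (hB : (d a + d e) ∈ (Matrix.det (∑ l, ((X : F[X]) ^ d l) • (S l).map (C : F →+* F[X]))).support ∧
      ∃ r : ℝ, 0 < r ∧ ∀ E' ∈ (Matrix.det (∑ l, ((X : F[X]) ^ d l) • (S l).map (C : F →+* F[X]))).support, E' ≠ d a + d e →
        v ((Matrix.det (∑ l, ((X : F[X]) ^ d l) • (S l).map (C : F →+* F[X]))).coeff E') * r ^ E'
          < v ((Matrix.det (∑ l, ((X : F[X]) ^ d l) • (S l).map (C : F →+* F[X]))).coeff (d a + d e)) * r ^ (d a + d e))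
    (hC : (d b + d c) ∈ (Matrix.det (∑ l, ((X : F[X]) ^ d l) • (S l).map (C : F →+* F[X]))).support ∧
      ∃ r : ℝ, 0 < r ∧ ∀ E' ∈ (Matrix.det (∑ l, ((X : F[X]) ^ d l) • (S l).map (C : F →+* F[X]))).support, E' ≠ d b + d c →
        v ((Matrix.det (∑ l, ((X : F[X]) ^ d l) • (S l).map (C : F →+* F[X]))).coeff E') * r ^ E'
          < v ((Matrix.det (∑ l, ((X : F[X]) ^ d l) • (S l).map (C : F →+* F[X]))).coeff (d b + d c)) * r ^ (d b + d c))
    (hlead_ae : v (S a 0 0 * S e 1 1 + S e 0 0 * S a 1 1 - 2 * S a 0 1 * S e 0 1)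
      = v ((Matrix.det (∑ l, ((X : F[X]) ^ d l) • (S l).map (C : F →+* F[X]))).coeff (d a + d e)))
    (hlead_bc : v (S b 0 0 * S c 1 1 + S c 0 0 * S b 1 1 - 2 * S b 0 1 * S c 0 1)
      = v ((Matrix.det (∑ l, ((X : F[X]) ^ d l) • (S l).map (C : F →+* F[X]))).coeff (d b + d c))) :
    False := by
  set f : F[X] := Matrix.det (∑ l, ((X : F[X]) ^ d l) • (S l).map (C : F →+* F[X])) with hf
  set Gm : Fin K → Fin K → F := fun i j => S i 0 0 * S j 1 1 + S j 0 0 * S i 1 1 - 2 * S i 0 1 * S j 0 1 with hGm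
  have hGsymm : ∀ i j, Gm i j = Gm j i := fun i j => by simp only [hGm]; ring
  have hlead_ae' : v (Gm a e) = v (f.coeff (d a + d e)) := hlead_ae
  have hlead_bc' : v (Gm b c) = v (f.coeff (d b + d c)) := hlead_bc
  set B : ℕ := d a + d e with hBdef
  set Cx : ℕ := d b + d c with hCdef
  have hda : d a < d b := hd hab
  have hdb : d b < d c := hd hbc
  have hdc : d c < d e := hd hce
  have hnb : d b + d b ≠ B := fun h0 => (ne_of_lt hab) (hap a e b h0.symm).1
  have hnc : d c + d c ≠ B := fun h0 => (ne_of_lt (hab.trans hbc)) (hap a e c h0.symm).1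
  -- the two dominance lines and their roof
  set ℓ : ℕ → ℝ := fun E => Real.log (v (f.coeff E)) with hℓ
  obtain ⟨sB, hsB⟩ := (exists_dominant_iff_exists_slope v f hB.1).1 hB.2
  obtain ⟨sC, hsC⟩ := (exists_dominant_iff_exists_slope v f hC.1).1 hC.2
  set p : ℝ := ℓ B + (B : ℝ) * sB with hp
  set q : ℝ := -sB with hq
  set p' : ℝ := ℓ Cx + (Cx : ℝ) * sC with hp'
  set q' : ℝ := -sC with hq'
  set h : ℝ → ℝ := fun t => min (p + q * t) (p' + q' * t) with hh
  have hmaj : ∀ E ∈ f.support, ℓ E ≤ h E := by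
    intro E hE
    refine le_min ?_ ?_
    · by_cases hEB : E = B
      · rw [hEB]; simp only [hp, hq]; linarith
      · have := hsB E hE hEB; simp only [hp, hq]; linarith
    · by_cases hEC : E = Cx
      · rw [hEC]; simp only [hp', hq']; linarith
      · have := hsC E hE hEC; simp only [hp', hq']; linarith
  have hmaj_lt : ∀ E ∈ f.support, E ≠ B → E ≠ Cx → ℓ E < h E := by
    intro E hE hEB hEC
    refine lt_min ?_ ?_
    · have := hsB E hE hEB; simp only [hp, hq]; linarith
    · have := hsC E hE hEC; simp only [hp', hq']; linarith
  have hhB : h B = ℓ B := le_antisymm ((min_le_left _ _).trans (by simp only [hp, hq]; linarith)) (hmaj B hB.1)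
  have hhC : h Cx = ℓ Cx := le_antisymm ((min_le_right _ _).trans (by simp only [hp', hq']; linarith)) (hmaj Cx hC.1)
  -- the two structural lemmas for this roof
  have hle0 : ∀ i j, Gm i j ≠ 0 → Real.log (v (Gm i j)) ≤ h ((d i + d j : ℕ) : ℝ) := fun i j hG =>
    log_polar_le_roof v hv d hd S hS hap p q p' q' (fun E hE => hmaj E hE) i j hG
  have hbtw : ∀ i j, Gm i j ≠ 0 → Real.log (v (Gm i j)) = h ((d i + d j : ℕ) : ℝ) →
      (d i + d j = B ∨ d i + d j = Cx) ∨ (i ≠ j ∧ min B Cx < d i + d j ∧ d i + d j < max B Cx) := fun i j hG htie =>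
    touching_polar_between v hv d hd S hS hap p q p' q' B Cx (fun E hE => hmaj E hE) (fun E hE h1 h2 => hmaj_lt E hE h1 h2)
      i j hG htie
  -- the four letters
  set ι : Fin 4 → Fin K := ![a, b, c, e] with hι
  have hι0 : ι 0 = a := rfl
  have hι1 : ι 1 = b := rfl
  have hι2 : ι 2 = c := rfl
  have hι3 : ι 3 = e := rfl
  have hmono : StrictMono (d ∘ ι) := by
    refine Fin.strictMono_iff_lt_succ.2 fun i => ?_
    fin_cases i
    · exact hda
    · exact hdb
    · exact hdc
  have e0 : ∀ h0 : 0 < 4, ι ⟨0, h0⟩ = a := fun _ => rfl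
  have e1 : ∀ h0 : 1 < 4, ι ⟨1, h0⟩ = b := fun _ => rfl
  have e2 : ∀ h0 : 2 < 4, ι ⟨2, h0⟩ = c := fun _ => rfl
  have e3 : ∀ h0 : 3 < 4, ι ⟨3, h0⟩ = e := fun _ => rfl
  -- cells of the quadruple: sum `B` / `Cx` only on the reversal, never strictly between
  have hcell : ∀ i j : Fin 4, (d (ι i) + d (ι j) = B → i = Fin.revPerm j) ∧ (d (ι i) + d (ι j) = Cx → i = Fin.revPerm j) ∧
      (i ≠ j → ¬ (min B Cx < d (ι i) + d (ι j) ∧ d (ι i) + d (ι j) < max B Cx)) := by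
    intro i j
    suffices hs : (d (ι i) + d (ι j) = B → i.val + j.val = 3) ∧ (d (ι i) + d (ι j) = Cx → i.val + j.val = 3) ∧
        (i.val ≠ j.val → ¬ (min B Cx < d (ι i) + d (ι j) ∧ d (ι i) + d (ι j) < max B Cx)) by
      refine ⟨fun h0 => Fin.ext ?_, fun h0 => Fin.ext ?_, fun hne => hs.2.2 fun h0 => hne (Fin.ext h0)⟩
      · rw [Fin.revPerm_apply, Fin.val_rev]; have := hs.1 h0; omega
      · rw [Fin.revPerm_apply, Fin.val_rev]; have := hs.2.1 h0; omega
    rcases i with ⟨iv, hiv⟩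
    rcases j with ⟨jv, hjv⟩
    simp only [ne_eq]
    rcases le_total B Cx with hle | hle
    · rw [min_eq_left hle, max_eq_right hle]
      interval_cases iv <;> interval_cases jv <;> simp only [e0, e1, e2, e3] <;>
        refine ⟨fun h1 => ?_, fun h2 => ?_, fun h3 => ?_⟩ <;> first | trivial | omega
    · rw [min_eq_right hle, max_eq_left hle]
      interval_cases iv <;> interval_cases jv <;> simp only [e0, e1, e2, e3] <;>
        refine ⟨fun h1 => ?_, fun h2 => ?_, fun h3 => ?_⟩ <;> first | trivial | omega
  have hrev_sum : ∀ l : Fin 4, d (ι (Fin.revPerm l)) + d (ι l) = B ∨ d (ι (Fin.revPerm l)) + d (ι l) = Cx := by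
    intro l
    fin_cases l
    · left; show d (ι 3) + d (ι 0) = B; rw [hι3, hι0, hBdef, Nat.add_comm]
    · right; show d (ι 2) + d (ι 1) = Cx; rw [hι2, hι1, hCdef, Nat.add_comm]
    · right; show d (ι 1) + d (ι 2) = Cx; rw [hι1, hι2]
    · left; show d (ι 0) + d (ι 3) = B; rw [hι0, hι3]
  -- the leading entries are nonzero and touch the roof
  have hGae : Gm a e ≠ 0 := fun h0 => by
    have : v (f.coeff B) = 0 := by rw [← hlead_ae', h0, map_zero]
    exact (Polynomial.mem_support_iff.1 hB.1) (v.eq_zero.1 this)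
  have hGbc : Gm b c ≠ 0 := fun h0 => by
    have : v (f.coeff Cx) = 0 := by rw [← hlead_bc', h0, map_zero]
    exact (Polynomial.mem_support_iff.1 hC.1) (v.eq_zero.1 this)
  have hrev_cell : ∀ l : Fin 4, Gm (ι (Fin.revPerm l)) (ι l) ≠ 0 ∧
      Real.log (v (Gm (ι (Fin.revPerm l)) (ι l))) = h ((d (ι (Fin.revPerm l)) + d (ι l) : ℕ) : ℝ) := by
    have kB : Real.log (v (Gm a e)) = h ((B : ℕ) : ℝ) := by rw [hlead_ae', hhB]
    have kC : Real.log (v (Gm b c)) = h ((Cx : ℕ) : ℝ) := by rw [hlead_bc', hhC]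
    intro l
    fin_cases l
    · show Gm (ι 3) (ι 0) ≠ 0 ∧ Real.log (v (Gm (ι 3) (ι 0))) = h ((d (ι 3) + d (ι 0) : ℕ) : ℝ)
      rw [hι3, hι0, hGsymm e a, Nat.add_comm]; exact ⟨hGae, kB⟩
    · show Gm (ι 2) (ι 1) ≠ 0 ∧ Real.log (v (Gm (ι 2) (ι 1))) = h ((d (ι 2) + d (ι 1) : ℕ) : ℝ)
      rw [hι2, hι1, hGsymm c b, Nat.add_comm]; exact ⟨hGbc, kC⟩
    · show Gm (ι 1) (ι 2) ≠ 0 ∧ Real.log (v (Gm (ι 1) (ι 2))) = h ((d (ι 1) + d (ι 2) : ℕ) : ℝ)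
      rw [hι1, hι2]; exact ⟨hGbc, kC⟩
    · show Gm (ι 0) (ι 3) ≠ 0 ∧ Real.log (v (Gm (ι 0) (ι 3))) = h ((d (ι 0) + d (ι 3) : ℕ) : ℝ)
      rw [hι0, hι3]; exact ⟨hGae, kB⟩
  -- the Gram minor
  set G : Matrix (Fin 4) (Fin 4) F :=
    Matrix.of fun i j : Fin 4 => S (ι i) 0 0 * S (ι j) 1 1 + S (ι j) 0 0 * S (ι i) 1 1 - 2 * S (ι i) 0 1 * S (ι j) 0 1 with hG
  have hdet : G.det = 0 := det_gram_polarDet_eq_zero (fun i => S (ι i) 0 0) (fun i => S (ι i) 0 1) (fun i => S (ι i) 1 1)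
  have hGG : ∀ i j, G i j = Gm (ι i) (ι j) := fun i j => by rw [hG, Matrix.of_apply]
  have hterm : ∀ σ : Equiv.Perm (Fin 4), v (Equiv.Perm.sign σ • ∏ l, G (σ l) l) = ∏ l, v (G (σ l) l) := by
    intro σ
    rcases Int.units_eq_one_or (Equiv.Perm.sign σ) with h1 | h1
    · rw [h1, one_smul, map_prod]
    · rw [h1, Units.neg_smul, one_smul, AbsoluteValue.map_neg, map_prod]
  set x : Fin 4 → Fin 4 → ℝ := fun i j => h ((d (ι i) + d (ι j) : ℕ) : ℝ) with hx
  have hxsymm : ∀ i j, x i j = x j i := fun i j => by simp only [hx, Nat.add_comm]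
  have hconc : ∀ p₁ q₁ p₂ q₂ p₃ q₃ p₄ q₄ : Fin 4,
      (d ∘ ι) p₁ + (d ∘ ι) q₁ + ((d ∘ ι) p₄ + (d ∘ ι) q₄) = (d ∘ ι) p₂ + (d ∘ ι) q₂ + ((d ∘ ι) p₃ + (d ∘ ι) q₃) →
      (d ∘ ι) p₁ + (d ∘ ι) q₁ < (d ∘ ι) p₂ + (d ∘ ι) q₂ → (d ∘ ι) p₁ + (d ∘ ι) q₁ < (d ∘ ι) p₃ + (d ∘ ι) q₃ →
      x p₁ q₁ + x p₄ q₄ ≤ x p₂ q₂ + x p₃ q₃ := by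
    intro p₁ q₁ p₂ q₂ p₃ q₃ p₄ q₄ hsum h12 h13
    simp only [Function.comp_apply] at hsum h12 h13
    simp only [hx, hh]
    refine min_affine_outer_le_inner _ _ _ _ _ _ _ _ ?_ ?_ ?_
    · exact_mod_cast h12.le
    · exact_mod_cast h13.le
    · exact_mod_cast hsum
  have heq : ∏ l, v (G (Fin.revPerm l) l) = Real.exp (∑ l : Fin 4, x (Fin.revPerm l) l) := by
    rw [Real.exp_sum]
    refine Finset.prod_congr rfl fun l _ => ?_
    rw [hGG, hx]
    simp only []
    rw [← (hrev_cell l).2, Real.exp_log (v.pos (hrev_cell l).1)]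
  have hmax : ∀ σ ∈ (univ : Finset (Equiv.Perm (Fin 4))), σ ≠ Fin.revPerm →
      v (Equiv.Perm.sign σ • ∏ l, G (σ l) l)
        < v (Equiv.Perm.sign (Fin.revPerm : Equiv.Perm (Fin 4)) • ∏ l, G ((Fin.revPerm : Equiv.Perm (Fin 4)) l) l) := by
    intro σ _ hσ
    rw [hterm, hterm, heq]
    by_cases hz : ∃ l, G (σ l) l = 0
    · obtain ⟨l, hl⟩ := hz
      rw [Finset.prod_eq_zero (Finset.mem_univ l) (by rw [hl, map_zero])]
      exact Real.exp_pos _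
    push Not at hz
    have hz' : ∀ l, Gm (ι (σ l)) (ι l) ≠ 0 := fun l => by rw [← hGG]; exact hz l
    have hprod : ∏ l, v (G (σ l) l) = Real.exp (∑ l, Real.log (v (G (σ l) l))) := by
      rw [Real.exp_sum]
      exact Finset.prod_congr rfl fun l _ => (Real.exp_log (v.pos (hz l))).symm
    rw [hprod]
    refine Real.exp_lt_exp.2 ?_
    have hle_l : ∀ l, Real.log (v (G (σ l) l)) ≤ x (σ l) l := fun l => by rw [hGG]; exact hle0 _ _ (hz' l)
    have hroof : ∑ l, x (σ l) l ≤ ∑ l, x (Fin.revPerm l) l := by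
      calc ∑ l, x (σ l) l = ∑ l, x l (σ l) := Finset.sum_congr rfl fun l _ => hxsymm _ _
        _ ≤ ∑ l, x l (Fin.revPerm l) := sum_perm_le_sum_rev x (d ∘ ι) (d ∘ ι) hmono hmono hconc _ σ le_rfl
        _ = ∑ l, x (Fin.revPerm l) l := Finset.sum_congr rfl fun l _ => hxsymm _ _
    by_cases hall : ∀ l, Real.log (v (G (σ l) l)) = x (σ l) l
    · -- all four cells touch the roof: each is a reversal cell
      exfalso
      apply hσ
      refine Equiv.ext fun l => ?_
      have htie : Real.log (v (Gm (ι (σ l)) (ι l))) = h ((d (ι (σ l)) + d (ι l) : ℕ) : ℝ) := by rw [← hGG]; exact hall l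
      obtain ⟨h1, h2, h3⟩ := hcell (σ l) l
      rcases hbtw (ι (σ l)) (ι l) (hz' l) htie with (hb | hc') | ⟨hne, hbt⟩
      · exact h1 hb
      · exact h2 hc'
      · exact absurd hbt (h3 fun h0 => hne (by rw [h0]))
    · push Not at hall
      obtain ⟨l₀, hl₀⟩ := hall
      have hlt_l : Real.log (v (G (σ l₀) l₀)) < x (σ l₀) l₀ := lt_of_le_of_ne (hle_l l₀) hl₀
      calc ∑ l, Real.log (v (G (σ l) l)) < ∑ l, x (σ l) l :=
            Finset.sum_lt_sum (fun l _ => hle_l l) ⟨l₀, Finset.mem_univ _, hlt_l⟩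
        _ ≤ ∑ l, x (Fin.revPerm l) l := hroof
  have hsum := abv_sum_eq_of_unique_max v hv (univ : Finset (Equiv.Perm (Fin 4)))
    (fun σ => Equiv.Perm.sign σ • ∏ l, G (σ l) l) (Finset.mem_univ (Fin.revPerm : Equiv.Perm (Fin 4))) hmax
  rw [← Matrix.det_apply, hdet, map_zero, hterm, heq] at hsum
  exact absurd hsum (ne_of_lt (Real.exp_pos _))
/-! ## §2 The count for sorted letters -/

/-- **at most `(2K − 3) + K` dominant exponents** for a symmetric `2 × 2` pencil with strictly increasing exponents on a support without
three-term progressions, ALL letters: every dominant class is tame (roof-excess lemma with the roof of two dominant classes), so it has a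
LEADING pair; leading pairs are never nested (`not_nested_leading_of_apfree`), so they form a chain of at most `2K − 3`
(✓ `card_le_of_pairChain`); the diagonal contributes at most `K`. [assembly] -/
theorem domCount_le_of_apfree_sorted (v : AbsoluteValue F ℝ) (hv : IsNonarchimedean v) {K : ℕ} (d : Fin K → ℕ) (hd : StrictMono d)
    (S : Fin K → Matrix (Fin 2) (Fin 2) F) (hS : ∀ l, (S l).IsSymm)
    (hap : ∀ l₁ l₂ l₃ : Fin K, d l₁ + d l₂ = d l₃ + d l₃ → l₁ = l₃ ∧ l₂ = l₃) :
    ((Matrix.det (∑ l, ((X : F[X]) ^ d l) • (S l).map (C : F →+* F[X]))).support.filter fun E =>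
        ∃ r : ℝ, 0 < r ∧ ∀ E' ∈ (Matrix.det (∑ l, ((X : F[X]) ^ d l) • (S l).map (C : F →+* F[X]))).support, E' ≠ E →
          v ((Matrix.det (∑ l, ((X : F[X]) ^ d l) • (S l).map (C : F →+* F[X]))).coeff E') * r ^ E'
            < v ((Matrix.det (∑ l, ((X : F[X]) ^ d l) • (S l).map (C : F →+* F[X]))).coeff E) * r ^ E).card
      ≤ (2 * K - 3) + K := by
  set f : F[X] := Matrix.det (∑ l, ((X : F[X]) ^ d l) • (S l).map (C : F →+* F[X])) with hf
  set Gm : Fin K → Fin K → F := fun i j => S i 0 0 * S j 1 1 + S j 0 0 * S i 1 1 - 2 * S i 0 1 * S j 0 1 with hGm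
  set D := f.support.filter fun E => ∃ r : ℝ, 0 < r ∧ ∀ E' ∈ f.support, E' ≠ E →
      v (f.coeff E') * r ^ E' < v (f.coeff E) * r ^ E with hD
  -- zero or one dominant class
  by_cases hD1 : ∀ E ∈ D, ∀ E' ∈ D, E = E'
  · rcases D.eq_empty_or_nonempty with h0 | ⟨E₀, hE₀⟩
    · rw [h0, Finset.card_empty]; exact Nat.zero_le _
    · have hDs : D = {E₀} := Finset.eq_singleton_iff_unique_mem.2 ⟨hE₀, fun E hE => hD1 E hE E₀ hE₀⟩
      rw [hDs, Finset.card_singleton]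
      have hne0 := Polynomial.mem_support_iff.1 (Finset.mem_filter.1 hE₀).1
      rw [hf, coeff_det_symmPencil_two d S hS] at hne0
      obtain ⟨p, -, -⟩ := Finset.exists_ne_zero_of_sum_ne_zero hne0
      have hK : 0 < K := Fin.pos p.1
      omega
  push Not at hD1
  obtain ⟨E₁, hE₁, E₂, hE₂, hne12⟩ := hD1
  -- every dominant class is tame: its entries are `v`-bounded by its coefficient
  have htame : ∀ E ∈ D, ∀ i j : Fin K, d i + d j = E → Gm i j ≠ 0 → v (Gm i j) ≤ v (f.coeff E) := by
    intro E hE i j hij hG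
    obtain ⟨E', hE', hEE'⟩ : ∃ E' ∈ D, E' ≠ E := by
      by_cases h1 : E₁ = E
      · exact ⟨E₂, hE₂, fun h2 => hne12 (h1.trans h2.symm)⟩
      · exact ⟨E₁, hE₁, h1⟩
    obtain ⟨hEsupp, hEdom⟩ := Finset.mem_filter.1 hE
    obtain ⟨hE'supp, hE'dom⟩ := Finset.mem_filter.1 hE'
    obtain ⟨sB, hsB⟩ := (exists_dominant_iff_exists_slope v f hEsupp).1 hEdom
    obtain ⟨sC, hsC⟩ := (exists_dominant_iff_exists_slope v f hE'supp).1 hE'dom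
    set ℓ : ℕ → ℝ := fun E => Real.log (v (f.coeff E)) with hℓ
    have hmaj : ∀ E'' ∈ f.support, Real.log (v (f.coeff E''))
        ≤ min (ℓ E + (E : ℝ) * sB + (-sB) * (E'' : ℝ)) (ℓ E' + (E' : ℝ) * sC + (-sC) * (E'' : ℝ)) := by
      intro E'' hE''
      refine le_min ?_ ?_
      · by_cases h0 : E'' = E
        · rw [h0]; simp only [hℓ]; linarith
        · have := hsB E'' hE'' h0; simp only [hℓ]; linarith
      · by_cases h0 : E'' = E'
        · rw [h0]; simp only [hℓ]; linarith
        · have := hsC E'' hE'' h0; simp only [hℓ]; linarith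
    have h := log_polar_le_roof v hv d hd S hS hap (ℓ E + (E : ℝ) * sB) (-sB) (ℓ E' + (E' : ℝ) * sC) (-sC) hmaj i j hG
    have h2 : Real.log (v (Gm i j)) ≤ ℓ E := by
      refine h.trans ((min_le_left _ _).trans (le_of_eq ?_))
      rw [hij]; ring
    exact (Real.log_le_log_iff (v.pos hG) (v.pos (Polynomial.mem_support_iff.1 hEsupp))).1 h2
  -- leading off-diagonal pairs of dominant classes, and the diagonal
  set Doff : Finset (Fin K × Fin K) := (univ : Finset (Fin K × Fin K)).filter fun p =>
    p.1 < p.2 ∧ d p.1 + d p.2 ∈ D ∧ v (Gm p.1 p.2) = v (f.coeff (d p.1 + d p.2)) with hDoff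
  set Diag : Finset ℕ := (univ : Finset (Fin K)).image fun i => d i + d i with hDiag
  have hcover : D ⊆ Doff.image (fun p => d p.1 + d p.2) ∪ Diag := by
    intro E hE
    rw [Finset.mem_union]
    by_cases hdiagE : ∃ i, d i + d i = E
    · right
      obtain ⟨i, hi⟩ := hdiagE
      exact Finset.mem_image.2 ⟨i, Finset.mem_univ _, hi⟩
    left
    push Not at hdiagE
    have hEsupp : E ∈ f.support := (Finset.mem_filter.1 hE).1
    have hne := Polynomial.mem_support_iff.1 hEsupp
    have hsum := coeff_eq_sum_polar d S hS hdiagE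
    set T := (univ : Finset (Fin K × Fin K)).filter (fun p => p.1 < p.2 ∧ d p.1 + d p.2 = E) with hT
    have hTne : T.Nonempty := by
      by_contra h0
      rw [Finset.not_nonempty_iff_eq_empty] at h0
      apply hne
      rw [hf, hsum, h0, Finset.sum_empty]
    obtain ⟨p, hp, hle⟩ := IsNonarchimedean.finset_image_add_of_nonempty hv
      (fun p : Fin K × Fin K => S p.1 0 0 * S p.2 1 1 + S p.2 0 0 * S p.1 1 1 - 2 * S p.1 0 1 * S p.2 0 1) hTne
    rw [← hsum] at hle
    obtain ⟨-, hp1, hp2⟩ := Finset.mem_filter.1 hp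
    have hle' : v (f.coeff E) ≤ v (Gm p.1 p.2) := hle
    have hG : Gm p.1 p.2 ≠ 0 := by
      intro h0
      rw [h0, map_zero] at hle'
      exact hne (v.eq_zero.1 (le_antisymm hle' (v.nonneg _)))
    have hge := htame E hE p.1 p.2 hp2 hG
    refine Finset.mem_image.2 ⟨p, Finset.mem_filter.2 ⟨Finset.mem_univ _, hp1, ?_, ?_⟩, hp2⟩
    · rw [hp2]; exact hE
    · rw [hp2]; exact le_antisymm hge hle'
  -- leading pairs form a chain
  have hchain : ∀ p ∈ Doff, ∀ p' ∈ Doff, p.1 < p'.1 → p.2 ≤ p'.2 := by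
    intro p hp p' hp' h1
    obtain ⟨-, hp12, hpD, hpv⟩ := Finset.mem_filter.1 hp
    obtain ⟨-, hp12', hpD', hpv'⟩ := Finset.mem_filter.1 hp'
    by_contra h2
    push Not at h2
    exact not_nested_leading_of_apfree v hv d hd S hS hap h1 hp12' h2
      (Finset.mem_filter.1 hpD) (Finset.mem_filter.1 hpD') hpv hpv'
  have hoff : Doff.card ≤ 2 * K - 3 := by
    have h := card_le_of_pairChain 0 Doff (fun p hp => by simpa using (Finset.mem_filter.1 hp).2.1) hchain
    simpa using h
  have hdiag : Diag.card ≤ K := Finset.card_image_le.trans (by rw [Finset.card_univ, Fintype.card_fin])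
  calc D.card ≤ (Doff.image (fun p => d p.1 + d p.2) ∪ Diag).card := Finset.card_le_card hcover
    _ ≤ (Doff.image fun p => d p.1 + d p.2).card + Diag.card := Finset.card_union_le _ _
    _ ≤ Doff.card + K := Nat.add_le_add Finset.card_image_le hdiag
    _ ≤ (2 * K - 3) + K := Nat.add_le_add_right hoff K

/-! ## §3 The AP-free law, unfolded -/

/-- **THE AP-FREE LAW (all `K`, ALL symmetric letters, every non-archimedean field), UNFOLDED.**  A symmetric `2 × 2` lacunary pencil
`Σ_l X^{d_l} S_l` whose support has NO THREE-TERM PROGRESSION (`d_{l₁} + d_{l₂} = 2 d_{l₃}` only for `l₁ = l₂ = l₃`; injectivity is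
implied) has at most `(2K − 3) + K` dominant exponents: `npEdges ≤ 3K − 4`, the SIDON value (✓ `valSidonTwo_unfolded`, sharp by
✓ `valSidonTwo_sharp_unfolded`) — with NO hypothesis on the letters (✓ `valAPFreeSupport_unfolded` needed every letter valuatively
nonsingular) and NO Sidon hypothesis (four-letter coincidences `d_x + d_w = d_y + d_z`, cancelling or not, never add an edge).  The 3-AP
hypothesis is necessary: ✓ `valNonSidonFive_unfolded` (support `(0,3,4,8,14)`, progression `0 + 8 = 4 + 4`) has `13 > 11` edges.
[sorting + `domCount_le_of_apfree_sorted`] -/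
theorem valAPFree_unfolded :
    ∀ (F : Type) [Field F] (v : AbsoluteValue F ℝ), IsNonarchimedean v →
      ∀ (K : ℕ) (d : Fin K → ℕ) (S : Fin K → Matrix (Fin 2) (Fin 2) F), (∀ l, (S l).IsSymm) →
        (∀ l₁ l₂ l₃ : Fin K, d l₁ + d l₂ = d l₃ + d l₃ → l₁ = l₃ ∧ l₂ = l₃) →
        ((Matrix.det (∑ l, ((X : F[X]) ^ d l) • (S l).map (C : F →+* F[X]))).support.filter fun E =>
            ∃ r : ℝ, 0 < r ∧ ∀ E' ∈ (Matrix.det (∑ l, ((X : F[X]) ^ d l) • (S l).map (C : F →+* F[X]))).support, E' ≠ E →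
              v ((Matrix.det (∑ l, ((X : F[X]) ^ d l) • (S l).map (C : F →+* F[X]))).coeff E') * r ^ E'
                < v ((Matrix.det (∑ l, ((X : F[X]) ^ d l) • (S l).map (C : F →+* F[X]))).coeff E) * r ^ E).card - 1
          ≤ 3 * K - 4 := by
  intro F _ v hv K d S hS hap
  have hdinj : Function.Injective d := by
    intro i j hij
    exact (hap i i j (by rw [hij])).1
  set σ : Equiv.Perm (Fin K) := Tuple.sort d with hσ
  have hmono : StrictMono (d ∘ σ) := (Tuple.monotone_sort d).strictMono_of_injective (hdinj.comp σ.injective)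
  have hS' : ∀ l, (S (σ l)).IsSymm := fun l => hS (σ l)
  have hap' : ∀ l₁ l₂ l₃ : Fin K, (d ∘ σ) l₁ + (d ∘ σ) l₂ = (d ∘ σ) l₃ + (d ∘ σ) l₃ → l₁ = l₃ ∧ l₂ = l₃ := by
    intro l₁ l₂ l₃ h
    obtain ⟨h1, h2⟩ := hap _ _ _ h
    exact ⟨σ.injective h1, σ.injective h2⟩
  have hf' : Matrix.det (∑ l, ((X : F[X]) ^ (d ∘ σ) l) • (S (σ l)).map (C : F →+* F[X]))
      = Matrix.det (∑ l, ((X : F[X]) ^ d l) • (S l).map (C : F →+* F[X])) :=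
    congrArg Matrix.det (Equiv.sum_comp σ (fun l => ((X : F[X]) ^ d l) • (S l).map (C : F →+* F[X])))
  have h := domCount_le_of_apfree_sorted v hv (d ∘ σ) hmono (fun l => S (σ l)) hS' hap'
  rw [hf'] at h
  omega

end Summit.ValiantsHypothesis.ValiantsHypothesis.Theorems.KPlusLogSqLaw.ValDoor
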